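import Summits.NavierStokesRegularity.FunctionalMining.NoGo.TopEigHeatKillingProfile
import Summits.NavierStokesRegularity.FunctionalMining.NoGo.TopEigFrameSpread
import HarnessLib

/-!
# FunctionalMining / NoGo — FRAME SPREAD OF A KILL, every real `q > 1`: along every killing
# sequence for Lemma L-λ(q), EVERY fixed axis `e` is `δ`-aligned with the top strain eigenframe on
# at most `2/(3 − δ) + o(1)` of `T³` (contact set `{eᵀSe = λ₁}`: at most `2/3 + o(1)`), and the
# frame is tilted against `e` by a Rayleigh defect `> δλ₁` on at least `(1 − δ)/(3 − δ) − o(1)`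

Search for candidate a priori estimates; no regularity claim. Cell `pub-nsfunc`, no-go seat
(gen 53), STAGED for the prove seat. A finite statement about smooth divergence-free fields on `T³`
and the static functional `Φ_q = ∫ (λ₁⁺)^q`; nothing about Navier–Stokes is proved or asserted, and
NO node of the lane is decided here: the hypothesis of the main theorem is the OPEN negation
`¬ TopEigHeatCoercivePos q` of Lemma L-λ(q) (door (b)/(F2) of `NOGO.md`), exactly as in
`NoGo/TopEigHeatKillingShape` (K59) and `NoGo/TopEigHeatKillingProfile` (K60).

CONTEXT. The tree's FRAME SPREAD file (`NoGo/TopEigFrameSpread`, K54) is a ONE-FIELD law: for a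
smooth divergence-free `v` on `T³` and a unit `e`, `(3 − δ) · ∫_{alignedSet v e δ} λ₁ ≤ 2 Φ₁(v)`
(`alignedSet v e δ = {x | (1 − δ) λ₁(x) ≤ eᵀS(x)e}`; zero mean of the strain plus `−2λ₁ ≤ eᵀSe`),
with the PLATEAU READING `plateau_aligned_measureReal_le`: `(3 − δ) · m · vol(alignedSet ∩ B) ≤
2 Φ₁(v)` whenever `m ≤ λ₁` on `B`. Its docstring states the consequence for killing families as a
design rule ((R13), records only), CONDITIONAL on flatness "`λ₁ ≈ m` on a plateau of measure
`→ 1`, `Φ₁ ≈ m`" — which at the time was itself only a reading of the mean-square flattening (K53b).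
K60 (`KillingProfile.tendsto_measureReal_topEig_far_of_killing`) has since PROVED the plateau along
every killing sequence and for every real `q > 1`: `vol{|λ₁⁺/Φ_q^{1/q} − 1| ≥ η} → 0`. This file
closes the loop: the frame-spread rule becomes a THEOREM about killing sequences.

CONTENT (`T³ = UnitAddTorus (Fin 3)`, `λ₁ = torusStrainTopEig`, `Φ_r = torusTopEigMoment r`,
`Λ := Φ_q^{1/q}`).
§ 1 JENSEN **`topEigMoment_one_rpow_le`** `Φ₁(v)^q ≤ Φ_q(v)` and **`topEigMoment_one_le_rpow_inv`**
`Φ₁(v) ≤ Λ` (`q ≥ 1`, unit volume; Mathlib `ConvexOn.map_integral_le` for `t ↦ t^q`) — the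
missing link "`Φ₁ ≲ m`".
§ 2 ONE FIELD (smooth divergence-free `v`, `Φ_q(v) > 0`, unit `e`, `δ < 3`, `η < 1`):
**`measureReal_aligned_inter_near_le`** `vol(alignedSet v e δ ∩ {|λ₁/Λ − 1| < η}) ≤
2/((3 − δ)(1 − η))` (K54's plateau reading with `m = (1 − η)Λ` and § 1), hence
**`measureReal_aligned_le`** `vol(alignedSet v e δ) ≤ 2/((3 − δ)(1 − η)) + vol{η ≤ |λ₁⁺/Λ − 1|}`.
§ 3 ALONG A KILLING SEQUENCE (real `q > 1`, `Φ_q(v_n) > 0`,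
`heatDissipation Φ_q (v_n)/Φ_q(v_n) → 0`):
**`eventually_measureReal_aligned_le_of_killing`** for every unit `e`, `δ < 3`, `ε > 0`:
eventually `vol(alignedSet (v n) e δ) ≤ 2/(3 − δ) + ε`; complement form
**`eventually_le_measureReal_misaligned_of_killing`**: eventually
`(1 − δ)/(3 − δ) − ε ≤ vol((alignedSet (v n) e δ)ᶜ)` — on that set `eᵀSe < (1 − δ)λ₁`, i.e. the top
frame is tilted against `e` by a Rayleigh defect `> δ λ₁`.
§ 4 ON THE NODE **`killing_frame_of_not_coercivePos`** (`1 < q`, hypothesis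
`¬ TopEigHeatCoercivePos q`): a killing sequence exists (K59) and satisfies § 3 for every axis.

MEANING FOR (F2) (design rule (R13), now with proof; records only). SHARPNESS: `2/3` at `δ = 0` is
attained by the two-phase iso-top portrait of the paper killing family (a uniaxial-top phase
`(Λ, −Λ/2, −Λ/2)` with top axis `e` on `2/3` of the torus, a biaxial phase `(Λ, Λ, −2Λ)` with `e`
the BOTTOM axis on `1/3`: there `eᵀSe = λ₁` resp. `= −2λ₁`, the two equality cases of K54's proof),
so the constant cannot be improved by this argument and the rule is CONSISTENT with door (e).
EXCLUSIONS, for every real `q > 1` and with proof: every sequence whose top eigen-direction stays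
`δ`-aligned (`δ < 1`) with one fixed axis on a set of measure `> 2/(3 − δ) + o(1)` — in particular
asymptotically on all of `T³` (fixed top axis, planar-director designs seen from the normal axis,
single-director laminates) — is NOT a killing sequence; together with K60 (amplitude frozen:
`λ₁ ≈ Λ` in measure) the kill must ROTATE its top frame through a definite solid angle on a
definite fraction (`≥ (1 − δ)/(3 − δ) − o(1)` off every axis) while keeping `λ₁` constant in
measure. What such a rotation costs in `heatDissipation Φ_q` (the FRAME COST) is NOT kernelised;
nothing here bounds `heatDissipation` from below for a general field.
Honest reading. STRUCTURE ONLY: the main theorem takes the OPEN negation as hypothesis; L-λ(q)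
stays OPEN in the kernel for every real `q > 1`; no 𝒦₀ row, no A12 count, no T_LD input. [ours =
§§ 2–4; folklore = Jensen]
FILING (prove seat g30, REQUEST #90): declarations byte-identical to the no-go seat's staged `TopEigHeatKillingFrame.STAGING.lean` 58daa62a08ae4397; this line is the only addition.
-/

noncomputable section

open MeasureTheory Filter Topology Set
open Literature.Analysis.FunctionSpaces

namespace Summit.NavierStokesRegularity.FunctionalMining.TopEig

namespace KillingFrame

/-! ## § 1 Jensen: `Φ₁ ≤ Φ_q^{1/q}` -/

section Jensen

variable {q : ℝ} {v : UnitAddTorus (Fin 3) → EuclideanSpace ℝ (Fin 3)}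

/-- JENSEN for the top-eigenvalue moments on the unit-volume torus: `Φ₁(v)^q ≤ Φ_q(v)` for
`q ≥ 1`. [folklore: Jensen's inequality for the convex power `t ↦ t^q` on `[0, ∞)`] -/
theorem topEigMoment_one_rpow_le (hq : 1 ≤ q) (hv : Torus.IsSmooth v) :
    torusTopEigMoment 1 v ^ q ≤ torusTopEigMoment q v := by
  have hfc : Continuous fun x => max (torusStrainTopEig v x) 0 :=
    (continuous_torusStrainTopEig hv).max continuous_const
  have hgc : Continuous fun x => (max (torusStrainTopEig v x) 0) ^ q :=
    hfc.rpow_const fun _ => Or.inr (by linarith)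
  have hJ := (convexOn_rpow hq).map_integral_le (μ := volume)
    (f := fun x => max (torusStrainTopEig v x) 0)
    (Real.continuous_rpow_const (by linarith)).continuousOn isClosed_Ici
    (ae_of_all _ fun x => mem_Ici.2 (le_max_right _ _)) hfc.integrable_unitAddTorus
    (by simpa [Function.comp_def] using hgc.integrable_unitAddTorus)
  unfold torusTopEigMoment
  simpa only [Real.rpow_one] using hJ

/-- Hence **`Φ₁(v) ≤ Φ_q(v)^{1/q}`** for `q ≥ 1`. [folklore] -/
theorem topEigMoment_one_le_rpow_inv (hq : 1 ≤ q) (hv : Torus.IsSmooth v) :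
    torusTopEigMoment 1 v ≤ torusTopEigMoment q v ^ (1 / q) := by
  have hq0 : q ≠ 0 := by positivity
  have h1 : 0 ≤ torusTopEigMoment 1 v := torusTopEigMoment_nonneg 1 v
  calc torusTopEigMoment 1 v = (torusTopEigMoment 1 v ^ q) ^ (1 / q) := by
        rw [one_div, Real.rpow_rpow_inv h1 hq0]
    _ ≤ torusTopEigMoment q v ^ (1 / q) :=
        Real.rpow_le_rpow (by positivity) (topEigMoment_one_rpow_le hq hv) (by positivity)

end Jensen

/-! ## § 2 One field: the aligned set of every axis, against the `Λ`-plateau -/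

section OneField

variable {q : ℝ} {v : UnitAddTorus (Fin 3) → EuclideanSpace ℝ (Fin 3)}

/-- **ALIGNED ∩ NEAR-PLATEAU.** For a smooth divergence-free `v` on `T³` with `Φ_q(v) > 0`
(`q ≥ 1`), a unit `e`, `δ < 3` and `η < 1`:
`vol(alignedSet v e δ ∩ {|λ₁⁺/Λ − 1| < η}) ≤ 2/((3 − δ)(1 − η))`, `Λ = Φ_q^{1/q}` — K54's plateau
reading with `m = (1 − η)Λ`, closed by Jensen `Φ₁ ≤ Λ`. [ours] -/
theorem measureReal_aligned_inter_near_le (hq : 1 ≤ q) (hv : Torus.IsSmooth v)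
    (hdiv : Torus.IsDivFree v) {e : Fin 3 → ℝ} (he : e ⬝ᵥ e = 1) {δ : ℝ} (hδ : δ < 3) {η : ℝ}
    (hη : η < 1) (hΦ : 0 < torusTopEigMoment q v) :
    volume.real (FrameSpread.alignedSet v e δ ∩
        {x | |max (torusStrainTopEig v x) 0 / torusTopEigMoment q v ^ (1 / q) - 1| < η}) ≤
      2 / ((3 - δ) * (1 - η)) := by
  set Λ : ℝ := torusTopEigMoment q v ^ (1 / q) with hΛdef
  have hΛ : 0 < Λ := Real.rpow_pos_of_pos hΦ _
  set B : Set (UnitAddTorus (Fin 3)) :=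
    {x | |max (torusStrainTopEig v x) 0 / Λ - 1| < η} with hBdef
  have hBm : MeasurableSet B :=
    measurableSet_lt ((((continuous_torusStrainTopEig hv).max continuous_const).div_const Λ).sub
      continuous_const).abs.measurable measurable_const
  -- on `B` the top eigenvalue is floored by `m = (1 − η) Λ`
  have hm : ∀ x ∈ B, (1 - η) * Λ ≤ torusStrainTopEig v x := by
    intro x hx
    have h0 : 0 ≤ torusStrainTopEig v x := torusStrainTopEig_nonneg (by simp) hv hdiv x
    have hxB : |max (torusStrainTopEig v x) 0 / Λ - 1| < η := hx
    have hx' : 1 - η < max (torusStrainTopEig v x) 0 / Λ := by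
      have := (abs_lt.1 hxB).1
      linarith
    rw [max_eq_left h0, lt_div_iff₀ hΛ] at hx'
    exact hx'.le
  have hK := FrameSpread.plateau_aligned_measureReal_le hv hdiv he hδ.le hBm hm
  have hJ : torusTopEigMoment 1 v ≤ Λ := topEigMoment_one_le_rpow_inv hq hv
  have hpos : 0 < (3 - δ) * (1 - η) := mul_pos (by linarith) (by linarith)
  rw [le_div_iff₀ hpos, mul_comm]
  -- cancel `Λ > 0` in `(3 − δ)(1 − η) Λ · vol ≤ 2 Φ₁ ≤ 2 Λ`
  have h2 : (3 - δ) * (1 - η) * volume.real (FrameSpread.alignedSet v e δ ∩ B) * Λ ≤ 2 * Λ := by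
    have : (3 - δ) * ((1 - η) * Λ * volume.real (FrameSpread.alignedSet v e δ ∩ B)) =
        (3 - δ) * (1 - η) * volume.real (FrameSpread.alignedSet v e δ ∩ B) * Λ := by ring
    linarith
  exact le_of_mul_le_mul_right h2 hΛ

/-- **ALIGNED VOLUME OF ONE FIELD.** Same hypotheses: `vol(alignedSet v e δ) ≤ 2/((3 − δ)(1 − η)) +
vol{η ≤ |λ₁⁺/Λ − 1|}` — the aligned set splits into its near-plateau part and the far set. [ours] -/
theorem measureReal_aligned_le (hq : 1 ≤ q) (hv : Torus.IsSmooth v) (hdiv : Torus.IsDivFree v)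
    {e : Fin 3 → ℝ} (he : e ⬝ᵥ e = 1) {δ : ℝ} (hδ : δ < 3) {η : ℝ} (hη : η < 1)
    (hΦ : 0 < torusTopEigMoment q v) :
    volume.real (FrameSpread.alignedSet v e δ) ≤ 2 / ((3 - δ) * (1 - η)) +
      volume.real
        {x | η ≤ |max (torusStrainTopEig v x) 0 / torusTopEigMoment q v ^ (1 / q) - 1|} := by
  set N : Set (UnitAddTorus (Fin 3)) :=
    {x | |max (torusStrainTopEig v x) 0 / torusTopEigMoment q v ^ (1 / q) - 1| < η} with hNdef
  set R : Set (UnitAddTorus (Fin 3)) :=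
    {x | η ≤ |max (torusStrainTopEig v x) 0 / torusTopEigMoment q v ^ (1 / q) - 1|} with hRdef
  have hsub : FrameSpread.alignedSet v e δ ⊆ (FrameSpread.alignedSet v e δ ∩ N) ∪ R := by
    intro x hx
    by_cases hlt : |max (torusStrainTopEig v x) 0 / torusTopEigMoment q v ^ (1 / q) - 1| < η
    · exact Or.inl ⟨hx, hlt⟩
    · exact Or.inr (not_lt.1 hlt)
  calc volume.real (FrameSpread.alignedSet v e δ)
      ≤ volume.real ((FrameSpread.alignedSet v e δ ∩ N) ∪ R) := measureReal_mono hsub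
    _ ≤ volume.real (FrameSpread.alignedSet v e δ ∩ N) + volume.real R := measureReal_union_le _ _
    _ ≤ 2 / ((3 - δ) * (1 - η)) + volume.real R := by
        gcongr
        exact measureReal_aligned_inter_near_le hq hv hdiv he hδ hη hΦ

end OneField

/-! ## § 3 Along a killing sequence -/

section Killing

variable {q : ℝ} {v : ℕ → UnitAddTorus (Fin 3) → EuclideanSpace ℝ (Fin 3)}

/-- Elementary: for `0 < a`, `0 < ε`, `η = min (1/2) (ε a / 8)`: `2/(a(1 − η)) ≤ 2/a + ε/2`.
[folklore] -/
theorem two_div_mul_one_sub_le {a ε : ℝ} (ha : 0 < a) (hε : 0 < ε) :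
    2 / (a * (1 - min (1 / 2) (ε * a / 8))) ≤ 2 / a + ε / 2 := by
  set η : ℝ := min (1 / 2) (ε * a / 8) with hηdef
  have hη1 : η ≤ 1 / 2 := min_le_left _ _
  have hη2 : η ≤ ε * a / 8 := min_le_right _ _
  have hη0 : 0 ≤ η := le_min (by norm_num) (by positivity)
  have h1η : 0 < 1 - η := by linarith
  rw [div_le_iff₀ (mul_pos ha h1η)]
  have ex : (2 / a + ε / 2) * (a * (1 - η)) = 2 * (1 - η) + ε * a * (1 - η) / 2 := by
    field_simp
  rw [ex]
  nlinarith [mul_nonneg (mul_pos hε ha).le (by linarith : (0 : ℝ) ≤ 1 - η - 1 / 2)]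

/-- **FRAME SPREAD OF A KILL, every real `q > 1`.** Along every killing sequence for Lemma L-λ(q)
(smooth, divergence-free, `Φ_q(v_n) > 0`, `heatDissipation Φ_q (v_n) / Φ_q(v_n) → 0`), for every
unit axis `e`, every `δ < 3` and every `ε > 0`: eventually
`vol(alignedSet (v n) e δ) ≤ 2/(3 − δ) + ε` — no fixed axis is `δ`-aligned with the top strain
eigenframe on more than `2/(3 − δ) + o(1)` of `T³`; at `δ = 0` the contact set `{eᵀSe = λ₁}` of
every axis has measure `≤ 2/3 + o(1)`. [ours] -/
theorem eventually_measureReal_aligned_le_of_killing (hq : 1 < q) (hv : ∀ n, Torus.IsSmooth (v n))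
    (hdv : ∀ n, Torus.IsDivFree (v n)) (hΦ : ∀ n, 0 < torusTopEigMoment q (v n))
    (hkill : Tendsto
      (fun n => heatDissipation (torusTopEigMoment q) (v n) / torusTopEigMoment q (v n))
      atTop (𝓝 0)) {e : Fin 3 → ℝ} (he : e ⬝ᵥ e = 1) {δ : ℝ} (hδ : δ < 3) {ε : ℝ} (hε : 0 < ε) :
    ∀ᶠ n in atTop, volume.real (FrameSpread.alignedSet (v n) e δ) ≤ 2 / (3 - δ) + ε := by
  have ha : 0 < 3 - δ := by linarith
  set η : ℝ := min (1 / 2) (ε * (3 - δ) / 8) with hηdef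
  have hη0 : 0 < η := lt_min (by norm_num) (by positivity)
  have hη1 : η < 1 := lt_of_le_of_lt (min_le_left _ _) (by norm_num)
  have key : 2 / ((3 - δ) * (1 - η)) ≤ 2 / (3 - δ) + ε / 2 := two_div_mul_one_sub_le ha hε
  have hfar := (tendsto_order.1
    (KillingProfile.tendsto_measureReal_topEig_far_of_killing hq hv hdv hΦ hkill hη0)).2
    (ε / 2) (by positivity)
  filter_upwards [hfar] with n hn
  have h1 := measureReal_aligned_le hq.le (hv n) (hdv n) he hδ hη1 (hΦ n)
  linarith

/-- **Complement form.** Same hypotheses: eventually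
`(1 − δ)/(3 − δ) − ε ≤ vol((alignedSet (v n) e δ)ᶜ)` — on a set of at least that measure the top
frame is tilted against `e` by a Rayleigh defect `> δλ₁` (`eᵀSe < (1 − δ)λ₁`); at `δ = 0`:
`≥ 1/3 − o(1)`. [ours] -/
theorem eventually_le_measureReal_misaligned_of_killing (hq : 1 < q)
    (hv : ∀ n, Torus.IsSmooth (v n)) (hdv : ∀ n, Torus.IsDivFree (v n))
    (hΦ : ∀ n, 0 < torusTopEigMoment q (v n))
    (hkill : Tendsto
      (fun n => heatDissipation (torusTopEigMoment q) (v n) / torusTopEigMoment q (v n))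
      atTop (𝓝 0)) {e : Fin 3 → ℝ} (he : e ⬝ᵥ e = 1) {δ : ℝ} (hδ : δ < 3) {ε : ℝ} (hε : 0 < ε) :
    ∀ᶠ n in atTop,
      (1 - δ) / (3 - δ) - ε ≤ volume.real (FrameSpread.alignedSet (v n) e δ)ᶜ := by
  have ha : (3 - δ) ≠ 0 := by linarith
  have hid : (1 - δ) / (3 - δ) = 1 - 2 / (3 - δ) := by
    field_simp
    ring
  filter_upwards [eventually_measureReal_aligned_le_of_killing hq hv hdv hΦ hkill he hδ hε]
    with n hn
  rw [probReal_compl_eq_one_sub (FrameSpread.measurableSet_alignedSet (hv n) e δ), hid]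
  linarith

end Killing

/-! ## § 4 On the node -/

section Node

variable {q : ℝ}

/-- **FRAME SPREAD OF A KILL, every real `q > 1`, on the node.** If Lemma L-λ(q) FAILS, there is a
killing sequence (K59 `killing_shape_of_not_coercivePos`: zero-mean admissible, `Φ_q > 0`,
`heatDissipation/Φ_q → 0`) along which EVERY fixed unit axis `e` is `δ`-aligned with the top strain
eigenframe on eventually at most `2/(3 − δ) + ε` of the torus (`δ < 3`, `ε > 0`), and misaligned
by a Rayleigh defect `> δλ₁` on eventually at least `(1 − δ)/(3 − δ) − ε`.
Hypothesis = the OPEN negation; NO node decided. [ours] -/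
theorem killing_frame_of_not_coercivePos (hq : 1 < q)
    (h : ¬ TopEigHeatCoercivePos (d := Fin 3) q) :
    ∃ v : ℕ → UnitAddTorus (Fin 3) → EuclideanSpace ℝ (Fin 3),
      (∀ n, Torus.IsSmooth (v n) ∧ Torus.IsDivFree (v n) ∧ Torus.HasZeroMean (v n) ∧
        0 < torusTopEigMoment q (v n)) ∧
      Tendsto (fun n => heatDissipation (torusTopEigMoment q) (v n) / torusTopEigMoment q (v n))
        atTop (𝓝 0) ∧
      ∀ e : Fin 3 → ℝ, e ⬝ᵥ e = 1 → ∀ δ : ℝ, δ < 3 → ∀ ε : ℝ, 0 < ε →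
        (∀ᶠ n in atTop, volume.real (FrameSpread.alignedSet (v n) e δ) ≤ 2 / (3 - δ) + ε) ∧
        (∀ᶠ n in atTop,
          (1 - δ) / (3 - δ) - ε ≤ volume.real (FrameSpread.alignedSet (v n) e δ)ᶜ) := by
  obtain ⟨v, hv, hkill, -, -, -⟩ := KillingShape.killing_shape_of_not_coercivePos hq h
  exact ⟨v, hv, hkill, fun e he δ hδ ε hε =>
    ⟨eventually_measureReal_aligned_le_of_killing hq (fun n => (hv n).1) (fun n => (hv n).2.1)
        (fun n => (hv n).2.2.2) hkill he hδ hε,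
      eventually_le_measureReal_misaligned_of_killing hq (fun n => (hv n).1)
        (fun n => (hv n).2.1) (fun n => (hv n).2.2.2) hkill he hδ hε⟩⟩

end Node

end KillingFrame

end Summit.NavierStokesRegularity.FunctionalMining.TopEig

end
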